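import Mathlib
import Literature.Analysis.FluidPDE.CheskidovFriedlander2009.FixedPoint
import HarnessLib

/-!
# Cheskidov–Friedlander 2009, Lemma 2.4: the flux-ratio bound `g_j(μ) < (1 − γ)λ^{−β/2}`

Cheskidov–Friedlander, Physica D 238 (2009) 783–787 = arXiv:0810.3718v1, Lemma 2.4 p. 6 (the
one property of the steady state used in §3, in the proof of the global attractor Thm. 3.4 = the
named fact `CheskidovFriedlander2009_globalAttractor`, discharged in `GlobalAttractor.lean`): "Let `A` be a fixed point.  Then there exists
`γ ∈ (0,1)`, such that `g_j(μ) := A_{j+1}/(A_j + A^{1/2}_{j+1}A^{1/2}_{j+2}) < (1 − γ)2^{−β/2}` for all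
`μ > 0` and `j ≥ 0`."  Here, in the vocabulary of `SteadyState.lean` (`IsSteadyState μ r A`,
`r = 2^β = 2^{2−2c/3} ∈ (1,2)`), PROVED following the printed proof:

* (2.5) `g_j < A_{j+1}/(A_j + A_{j+2})` (monotonicity, Thm. 2.2 = `IsSteadyState.strictAnti`);
* (2.6)–(2.7) `A_{j+2} > A_j(√(y² + z²) − z)` with `y = A_{j+1}/A_j ∈ (0,1)`,
  `z = μr^{j+2}/(2A_j)`, from `A²_{j+1} − μr^{j+2}A_{j+2} = A_{j+2}A_{j+3} < A²_{j+2}`;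
* (2.8) `yz < r/2` (from `A_{j+1} < A_j²/(μr^{j+1})`);
* hence `g_j < y/(1 − z + √(y² + z²))`, and the elementary maximisation
  (`ratio_aux_le`): under `0 < y ≤ 1`, `0 ≤ z`, `yz ≤ a = r/2 ∈ [1/2, 1]` one has
  `y/(1 − z + √(y²+z²)) ≤ 1/(1 − a + √(1 + a²)) = h(1, β)` (the printed "`∂h/∂y > 0`, `h` attains
  its maximum at `y = 1`" is replaced by a direct algebraic verification);
* `h(1,β)·√r < 1` for `r < 2` (`sqrt_lt_theta_inv`), so `γ := 1 − √r·h(1,β) ∈ (0,1)` works: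
  `IsSteadyState.ratio_lt`, `IsSteadyState.exists_gamma_ratio_lt` (Lemma 2.4 as printed).

In the original variables (`FixedPoint.lean`: a non-negative `ℓ²` fixed point `α` of viscosity
`ν > 0` rescales to a steady state) the same bound reads
`α_{j+1}/(α_j + √(2^cα_{j+1}α_{j+2})) < (1 − γ)/2` (`exists_gamma_fluxRatio_lt`), equivalently the
coefficient bound used in (3.9)–(3.10):
`2^{cj}(α_j − √(2^cα_{j+1}α_{j+2})) < (1 − γ)ν2^{2j+1}` (`exists_gamma_coeff_sub_sqrt_lt`), with
`γ` depending on `c ∈ (3/2, 3)` only.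

## References
* [CheskidovFriedlander2009] A. Cheskidov, S. Friedlander, The vanishing viscosity limit for a
  dyadic model, Physica D 238 (2009) 783–787, Lemma 2.4 p. 6 (and (3.9)–(3.10) p. 8).
-/

noncomputable section

open Set Filter

namespace Literature.Analysis.FluidPDE.CheskidovFriedlander2009

/-! ### The elementary maximisation -/

/-- The real-variable inequality behind Lemma 2.4: for `1/2 ≤ a ≤ 1`, `0 < y ≤ 1`, `0 ≤ z` and
`yz ≤ a`, `y·(1 − a + √(1 + a²)) ≤ 1 − z + √(y² + z²)`; i.e. the function
`y/(1 − z + √(y² + z²))` of the printed proof is at most its value `1/(1 − a + √(1 + a²))` at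
`y = 1`, `z = a`. [cite: CheskidovFriedlander2009, Lemma 2.4 p.6 (proof)] -/
theorem ratio_aux_le {a y z : ℝ} (ha : 1 / 2 ≤ a) (ha1 : a ≤ 1) (hy : 0 < y) (hy1 : y ≤ 1)
    (hz : 0 ≤ z) (hyz : y * z ≤ a) :
    y * (1 - a + Real.sqrt (1 + a ^ 2)) ≤ 1 - z + Real.sqrt (y ^ 2 + z ^ 2) := by
  set s : ℝ := Real.sqrt (1 + a ^ 2) with hs
  have hs2 : s ^ 2 = 1 + a ^ 2 := Real.sq_sqrt (by positivity)
  have hs1 : 1 ≤ s := by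
    rw [hs, Real.le_sqrt (by norm_num) (by positivity)]
    nlinarith
  have hs11 : 11 / 10 ≤ s := by
    rw [hs, Real.le_sqrt (by norm_num) (by positivity)]
    nlinarith
  have hsle : s ≤ 1 + a := by
    rw [hs, Real.sqrt_le_left (by linarith)]
    nlinarith
  set c : ℝ := 1 - a + s with hc
  -- the quadratic relation satisfied by `c`
  have hc2 : c ^ 2 = 2 * (1 - a) * c + 2 * a := by
    rw [hc]
    linear_combination hs2
  have hc1 : 11 / 10 ≤ c := by
    rw [hc]
    linarith
  set w : ℝ := Real.sqrt (y ^ 2 + z ^ 2) with hw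
  have hw0 : 0 ≤ w := Real.sqrt_nonneg _
  have hwz : z ≤ w := Real.le_sqrt_of_sq_le (by nlinarith)
  by_cases h1 : y * c + z ≤ 1
  · linarith
  push Not at h1
  -- it suffices to compare squares
  have key : (y * c + z - 1) ^ 2 ≤ y ^ 2 + z ^ 2 := by
    by_cases h2 : y * c ≤ 1
    · nlinarith [mul_nonneg (sub_nonneg.2 h2) (by linarith : (0 : ℝ) ≤ z - (1 - y * c))]
    · push Not at h2
      -- the quadratic `q(y) = Ay² + By + 2a`, `A = 2(1−a)c + 2a − 1 > 0`, `B = 2a − 1 − 2ac`,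
      -- has negative discriminant, and `y·((yc+z−1)² − y² − z²) ≤ (y − 1)·q(y) ≤ 0`
      have hA : 0 < 2 * (1 - a) * c + 2 * a - 1 := by
        nlinarith [mul_nonneg (sub_nonneg.2 ha1) (by linarith : (0 : ℝ) ≤ c - 11 / 10)]
      have hK : 0 ≤ 12 * a - 16 * a ^ 2 + 8 * a ^ 3 := by
        have : 12 * a - 16 * a ^ 2 + 8 * a ^ 3 = 4 * a * (2 * (a - 1) ^ 2 + 1) := by ring
        rw [this]
        positivity
      have hm : 1 ≤ -8 * a ^ 4 + 24 * a ^ 3 - 32 * a ^ 2 + 20 * a - 1 := by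
        have : -8 * a ^ 4 + 24 * a ^ 3 - 32 * a ^ 2 + 20 * a - 1 =
            4 * a * ((1 - a) * (2 * (a - 1) ^ 2 + 2)) + (4 * a - 1) := by ring
        rw [this]
        have : 0 ≤ 4 * a * ((1 - a) * (2 * (a - 1) ^ 2 + 2)) := by
          have : 0 ≤ 1 - a := by linarith
          positivity
        linarith
      have hD : 8 * a * (2 * (1 - a) * c + 2 * a - 1) - (2 * a - 1 - 2 * a * c) ^ 2 =
          (-8 * a ^ 4 + 24 * a ^ 3 - 32 * a ^ 2 + 20 * a - 1)
            + (s - 1) * (12 * a - 16 * a ^ 2 + 8 * a ^ 3) := by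
        rw [hc]
        linear_combination (-4 * a ^ 2) * hs2
      have hdisc : 0 < 8 * a * (2 * (1 - a) * c + 2 * a - 1) - (2 * a - 1 - 2 * a * c) ^ 2 := by
        rw [hD]
        nlinarith [mul_nonneg (sub_nonneg.2 hs1) hK]
      have h4q : 4 * (2 * (1 - a) * c + 2 * a - 1) *
          ((2 * (1 - a) * c + 2 * a - 1) * y ^ 2 + (2 * a - 1 - 2 * a * c) * y + 2 * a) =
          (2 * (2 * (1 - a) * c + 2 * a - 1) * y + (2 * a - 1 - 2 * a * c)) ^ 2
            + (8 * a * (2 * (1 - a) * c + 2 * a - 1) - (2 * a - 1 - 2 * a * c) ^ 2) := by ring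
      have hq : 0 < (2 * (1 - a) * c + 2 * a - 1) * y ^ 2 + (2 * a - 1 - 2 * a * c) * y + 2 * a := by
        have h4 : 0 < 4 * (2 * (1 - a) * c + 2 * a - 1) *
            ((2 * (1 - a) * c + 2 * a - 1) * y ^ 2 + (2 * a - 1 - 2 * a * c) * y + 2 * a) := by
          rw [h4q]
          nlinarith [sq_nonneg (2 * (2 * (1 - a) * c + 2 * a - 1) * y + (2 * a - 1 - 2 * a * c))]
        by_contra hcon
        push Not at hcon
        have := mul_nonpos_of_nonneg_of_nonpos
          (by linarith : (0 : ℝ) ≤ 4 * (2 * (1 - a) * c + 2 * a - 1)) hcon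
        linarith
      have hprod : 0 ≤ (y * c - 1) * (a - y * z) := mul_nonneg (by linarith) (by linarith)
      have hid : y * ((y * c + z - 1) ^ 2 - (y ^ 2 + z ^ 2)) =
          (y - 1) * ((2 * (1 - a) * c + 2 * a - 1) * y ^ 2 + (2 * a - 1 - 2 * a * c) * y + 2 * a)
            + y ^ 3 * (c ^ 2 - 2 * (1 - a) * c - 2 * a) - 2 * ((y * c - 1) * (a - y * z)) := by
        ring
      have hz3 : y ^ 3 * (c ^ 2 - 2 * (1 - a) * c - 2 * a) = 0 := by
        rw [hc2]
        ring
      have hneg : (y - 1) * ((2 * (1 - a) * c + 2 * a - 1) * y ^ 2 + (2 * a - 1 - 2 * a * c) * y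
          + 2 * a) ≤ 0 := mul_nonpos_of_nonpos_of_nonneg (by linarith) hq.le
      have hyQ : y * ((y * c + z - 1) ^ 2 - (y ^ 2 + z ^ 2)) ≤ 0 := by
        rw [hid, hz3]
        linarith
      by_contra hcon
      push Not at hcon
      have := mul_pos hy (sub_pos.2 hcon)
      linarith
  have : y * c + z - 1 ≤ w := Real.le_sqrt_of_sq_le key
  linarith

/-- `√r < 1 − r/2 + √(1 + (r/2)²)` for `0 < r < 2` (equality at `r = 2`): the constant of
Lemma 2.4 is `< 2^{−β/2} = r^{−1/2}` "provided `β < 1`, i.e., provided `c > 3/2`".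
[cite: CheskidovFriedlander2009, Lemma 2.4 p.6 (proof, last display)] -/
theorem sqrt_lt_theta_inv {r : ℝ} (hr0 : 0 < r) (hr2 : r < 2) :
    Real.sqrt r < 1 - r / 2 + Real.sqrt (1 + (r / 2) ^ 2) := by
  have hs1 : 1 ≤ Real.sqrt (1 + (r / 2) ^ 2) := by
    rw [Real.le_sqrt (by norm_num) (by positivity)]
    nlinarith
  by_cases h : Real.sqrt r ≤ 1 - r / 2
  · linarith
  push Not at h
  -- square: `(√r − (1 − r/2))² < 1 + (r/2)²` iff `(1 − r/2)·√r > 0`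
  have hsq : (Real.sqrt r - (1 - r / 2)) ^ 2 < 1 + (r / 2) ^ 2 := by
    have hr : Real.sqrt r ^ 2 = r := Real.sq_sqrt hr0.le
    have hpos : 0 < (1 - r / 2) * Real.sqrt r := mul_pos (by linarith) (Real.sqrt_pos.2 hr0)
    nlinarith
  have := (Real.lt_sqrt (by linarith)).2 hsq
  linarith

/-! ### Lemma 2.4 in the rescaled variables -/

namespace IsSteadyState

variable {μ r : ℝ} {A : ℕ → ℝ}

/-- **Lemma 2.4, pointwise form**: every steady state with `μ > 0`, `1 < r < 2` has
`g_j = A_{j+1}/(A_j + √(A_{j+1}A_{j+2})) < 1/(1 − r/2 + √(1 + (r/2)²))` for all `j`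
(the printed `h(1,β)` with `2^{β−1} = r/2`). [cite: CheskidovFriedlander2009, Lemma 2.4 p.6] -/
theorem ratio_lt (h : IsSteadyState μ r A) (hμ : 0 < μ) (hr1 : 1 < r) (hr2 : r < 2) (j : ℕ) :
    A (j + 1) / (A j + Real.sqrt (A (j + 1) * A (j + 2))) <
      1 / (1 - r / 2 + Real.sqrt (1 + (r / 2) ^ 2)) := by
  have h0 := h.pos j
  have h1 := h.pos (j + 1)
  have h2 := h.pos (j + 2)
  have h3 := h.pos (j + 3)
  have hm0 := h.strictAnti hμ hr1 hr2 j
  have hm1 := h.strictAnti hμ hr1 hr2 (j + 1)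
  have hm2 : A (j + 3) < A (j + 2) := h.strictAnti hμ hr1 hr2 (j + 2)
  have he0 := h.eq_succ j
  have he1 : A (j + 1) ^ 2 - A (j + 2) * A (j + 3) = μ * r ^ (j + 2) * A (j + 2) :=
    h.eq_succ (j + 1)
  have hr0 : 0 < r := by linarith
  have hrp : 0 < μ * r ^ (j + 2) := by positivity
  -- `y = A_{j+1}/A_j`, `z = μr^{j+2}/(2A_j)`
  set y : ℝ := A (j + 1) / A j with hy
  set z : ℝ := μ * r ^ (j + 2) / (2 * A j) with hz
  have hy0 : 0 < y := div_pos h1 h0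
  have hy1 : y ≤ 1 := by
    rw [hy, div_le_one h0]
    exact hm0.le
  have hz0 : 0 ≤ z := by positivity
  have hyA : A (j + 1) = y * A j := by
    rw [hy]
    field_simp
  have hzA : μ * r ^ (j + 2) = 2 * z * A j := by
    rw [hz]
    field_simp
  -- (2.8) `yz < r/2`: from `μr^{j+1}A_{j+1} < A_j²`
  have hyz : y * z ≤ r / 2 := by
    have hlt : μ * r ^ (j + 1) * A (j + 1) < A j ^ 2 := by nlinarith [mul_pos h1 h2]
    have : y * z = r * (μ * r ^ (j + 1) * A (j + 1)) / (2 * A j ^ 2) := by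
      rw [hy, hz]
      field_simp
      ring
    rw [this, div_le_iff₀ (by positivity)]
    nlinarith [mul_le_mul_of_nonneg_left hlt.le hr0.le]
  -- (2.7) `A_{j+2} + zA_j > A_j√(y² + z²)`
  set w : ℝ := Real.sqrt (y ^ 2 + z ^ 2) with hw
  have hsq : A j ^ 2 * (y ^ 2 + z ^ 2) < (A (j + 2) + z * A j) ^ 2 := by
    have hlt : A (j + 1) ^ 2 < A (j + 2) ^ 2 + μ * r ^ (j + 2) * A (j + 2) := by
      nlinarith [mul_lt_mul_of_pos_left hm2 h2]
    rw [hzA] at hlt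
    have hA1 : A (j + 1) ^ 2 = y ^ 2 * A j ^ 2 := by
      rw [hyA]
      ring
    nlinarith [hA1]
  have hAw : A j * w < A (j + 2) + z * A j := by
    have : A j * w = Real.sqrt (A j ^ 2 * (y ^ 2 + z ^ 2)) := by
      rw [Real.sqrt_mul (sq_nonneg _), Real.sqrt_sq h0.le]
    rw [this]
    exact (Real.sqrt_lt' (by positivity)).2 hsq
  have hzw : z ≤ w := Real.le_sqrt_of_sq_le (by nlinarith)
  have hD : 0 < 1 - z + w := by linarith
  have hθ : 0 < 1 - r / 2 + Real.sqrt (1 + (r / 2) ^ 2) := by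
    have := Real.sqrt_nonneg (1 + (r / 2) ^ 2)
    linarith
  -- (2.5) and the substitution
  have hsqrt : A (j + 2) < Real.sqrt (A (j + 1) * A (j + 2)) :=
    (Real.lt_sqrt h2.le).2 (by nlinarith)
  calc A (j + 1) / (A j + Real.sqrt (A (j + 1) * A (j + 2)))
      < A (j + 1) / (A j + A (j + 2)) := div_lt_div_of_pos_left h1 (by positivity) (by linarith)
    _ < y / (1 - z + w) := by
        rw [div_lt_div_iff₀ (by positivity) hD, hyA]
        nlinarith [mul_lt_mul_of_pos_left hAw hy0]
    _ ≤ 1 / (1 - r / 2 + Real.sqrt (1 + (r / 2) ^ 2)) := by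
        have hle := ratio_aux_le (a := r / 2) (by linarith) (by linarith) hy0 hy1 hz0 hyz
        rw [div_le_div_iff₀ hD hθ, one_mul]
        linarith

/-- **Lemma 2.4 (Cheskidov–Friedlander 2009), as printed**: for `1 < r < 2` (`r = 2^β`,
`β = 2 − 2c/3 ∈ (0,1)`, i.e. `c ∈ (3/2, 3)`) there is `γ ∈ (0,1)`, depending on `r` only, such
that every steady state `A` of (2.1) with any `μ > 0` satisfies
`g_j(μ) = A_{j+1}/(A_j + A^{1/2}_{j+1}A^{1/2}_{j+2}) < (1 − γ)2^{−β/2} = (1 − γ)/√r` for all `j ≥ 0`.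
[cite: CheskidovFriedlander2009, Lemma 2.4 p.6] -/
theorem exists_gamma_ratio_lt {r : ℝ} (hr1 : 1 < r) (hr2 : r < 2) :
    ∃ γ : ℝ, 0 < γ ∧ γ < 1 ∧ ∀ ⦃μ : ℝ⦄ ⦃A : ℕ → ℝ⦄, 0 < μ → IsSteadyState μ r A →
      ∀ j, A (j + 1) / (A j + Real.sqrt (A (j + 1) * A (j + 2))) < (1 - γ) / Real.sqrt r := by
  have hr0 : 0 < r := by linarith
  set θinv : ℝ := 1 - r / 2 + Real.sqrt (1 + (r / 2) ^ 2) with hθinv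
  have hlt : Real.sqrt r < θinv := sqrt_lt_theta_inv hr0 hr2
  have hsr : 0 < Real.sqrt r := Real.sqrt_pos.2 hr0
  have hθ : 0 < θinv := hsr.trans hlt
  refine ⟨1 - Real.sqrt r / θinv, by rw [sub_pos, div_lt_one hθ]; exact hlt,
    by have := div_pos hsr hθ; linarith, fun μ A hμ hA j => ?_⟩
  have : (1 - (1 - Real.sqrt r / θinv)) / Real.sqrt r = 1 / θinv := by
    field_simp
    ring
  rw [this]
  exact hA.ratio_lt hμ hr1 hr2 j

end IsSteadyState

/-! ### Lemma 2.4 in the original variables -/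

variable {c ν f₀ : ℝ} {α : ℕ → ℝ}

/-- `√r = 2·2^{−c/3}` for `r = 2^{2 − 2c/3}`. [cite: CheskidovFriedlander2009, §2 p.4] -/
theorem sqrt_r_eq (c : ℝ) : Real.sqrt ((2 : ℝ) ^ (2 - 2 * c / 3)) = 2 * (2 : ℝ) ^ (-(c / 3)) := by
  have hq : 0 ≤ (2 : ℝ) ^ (-(c / 3)) := (Real.rpow_pos_of_pos two_pos _).le
  rw [two_rpow_beta_eq, show (4 : ℝ) * ((2 : ℝ) ^ (-(c / 3))) ^ 2 = (2 * (2 : ℝ) ^ (-(c / 3))) ^ 2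
    by ring, Real.sqrt_sq (by positivity)]

/-- The flux ratio of a fixed point in the original variables is `2^{−c/3}` times the rescaled
one: `α_{j+1}/(α_j + √(2^cα_{j+1}α_{j+2})) = 2^{−c/3}·A_{j+1}/(A_j + √(A_{j+1}A_{j+2}))` with
`A_j = α_j/α⁰_j` (uses `2^c·(2^{−c/3})³ = 1`). [cite: CheskidovFriedlander2009, §2 p.4 and Lemma 2.4 p.6] -/
theorem fluxRatio_eq_rescaled (c : ℝ) (hf : 0 < f₀) (α : ℕ → ℝ) (j : ℕ) :
    α (j + 1) / (α j + Real.sqrt ((2 : ℝ) ^ c * α (j + 1) * α (j + 2))) =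
      (2 : ℝ) ^ (-(c / 3)) * ((α (j + 1) / inviscidFixedPoint c f₀ (j + 1)) /
        (α j / inviscidFixedPoint c f₀ j +
          Real.sqrt ((α (j + 1) / inviscidFixedPoint c f₀ (j + 1)) *
            (α (j + 2) / inviscidFixedPoint c f₀ (j + 2))))) := by
  have hpq : (2 : ℝ) ^ c * ((2 : ℝ) ^ (-(c / 3))) ^ 3 = 1 := two_rpow_mul_ratio_pow_three c
  have hq0 : 0 < (2 : ℝ) ^ (-(c / 3)) := Real.rpow_pos_of_pos two_pos _
  have hφ0 : ∀ i, 0 < inviscidFixedPoint c f₀ i := inviscidFixedPoint_pos c hf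
  have hφ : ∀ i, inviscidFixedPoint c f₀ (i + 1) = inviscidFixedPoint c f₀ i * (2 : ℝ) ^ (-(c / 3)) :=
    fun i => by unfold inviscidFixedPoint; ring
  -- abbreviations
  set q : ℝ := (2 : ℝ) ^ (-(c / 3)) with hq
  set K : ℝ := inviscidFixedPoint c f₀ j with hK
  have hK0 : 0 < K := hφ0 j
  have hK1 : inviscidFixedPoint c f₀ (j + 1) = K * q := hφ j
  have hK2 : inviscidFixedPoint c f₀ (j + 2) = K * q * q := by rw [hφ (j + 1), hK1]
  rw [hK1, hK2]
  set A0 : ℝ := α j / K with hA0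
  set A1 : ℝ := α (j + 1) / (K * q) with hA1
  set A2 : ℝ := α (j + 2) / (K * q * q) with hA2
  have e0 : α j = K * A0 := by rw [hA0]; field_simp
  have e1 : α (j + 1) = K * q * A1 := by rw [hA1]; field_simp
  have e2 : α (j + 2) = K * q * q * A2 := by rw [hA2]; field_simp
  -- `√(2^c α_{j+1} α_{j+2}) = K √(A₁A₂)`
  have hinner : (2 : ℝ) ^ c * α (j + 1) * α (j + 2) = K ^ 2 * (A1 * A2) := by
    rw [e1, e2]
    linear_combination (K ^ 2 * A1 * A2) * hpq
  have hsqrt : Real.sqrt ((2 : ℝ) ^ c * α (j + 1) * α (j + 2)) = K * Real.sqrt (A1 * A2) := by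
    rw [hinner, Real.sqrt_mul (sq_nonneg _), Real.sqrt_sq hK0.le]
  rw [hsqrt, e1, e0]
  have hS := Real.sqrt_nonneg (A1 * A2)
  by_cases hden : A0 + Real.sqrt (A1 * A2) = 0
  · -- degenerate denominator: both sides are `0` by the convention `x/0 = 0`
    rw [show K * A0 + K * Real.sqrt (A1 * A2) = K * (A0 + Real.sqrt (A1 * A2)) by ring, hden,
      mul_zero, div_zero, div_zero, mul_zero]
  · rw [show K * A0 + K * Real.sqrt (A1 * A2) = K * (A0 + Real.sqrt (A1 * A2)) by ring]
    field_simp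

/-- **Lemma 2.4 for fixed points in the original variables**: for `3/2 < c < 3` there is
`γ ∈ (0,1)` (depending on `c` only) such that every non-negative `ℓ²` fixed point `α` of the
viscous model (`ν > 0`, force `f₀ > 0`) satisfies
`α_{j+1}/(α_j + √(2^cα_{j+1}α_{j+2})) < (1 − γ)/2` for all `j`
(`= 2^{−c/3}g_j < 2^{−c/3}(1 − γ)2^{−β/2} = (1 − γ)/2`).
[cite: CheskidovFriedlander2009, Lemma 2.4 p.6 and (3.9)–(3.10) p.8] -/
theorem exists_gamma_fluxRatio_lt (hc : 3 / 2 < c) (hc3 : c < 3) :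
    ∃ γ : ℝ, 0 < γ ∧ γ < 1 ∧ ∀ ⦃ν f₀ : ℝ⦄ ⦃α : ℕ → ℝ⦄, 0 < ν → 0 < f₀ →
      IsFixedPoint c ν (force f₀) α → (∀ j, 0 ≤ α j) →
        ∀ j, α (j + 1) / (α j + Real.sqrt ((2 : ℝ) ^ c * α (j + 1) * α (j + 2))) < (1 - γ) / 2 := by
  have hr1 : 1 < (2 : ℝ) ^ (2 - 2 * c / 3) := Real.one_lt_rpow (by norm_num) (by linarith)
  have hr2 : (2 : ℝ) ^ (2 - 2 * c / 3) < 2 :=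
    calc (2 : ℝ) ^ (2 - 2 * c / 3) < (2 : ℝ) ^ (1 : ℝ) :=
          Real.rpow_lt_rpow_of_exponent_lt (by norm_num) (by linarith)
      _ = 2 := Real.rpow_one 2
  obtain ⟨γ, hγ0, hγ1, hγ⟩ := IsSteadyState.exists_gamma_ratio_lt hr1 hr2
  refine ⟨γ, hγ0, hγ1, fun ν f₀ α hν hf hα hnn j => ?_⟩
  have hμ : 0 < ν * (2 : ℝ) ^ (c / 6) / Real.sqrt f₀ := by
    have : 0 < (2 : ℝ) ^ (c / 6) := Real.rpow_pos_of_pos two_pos _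
    have : 0 < Real.sqrt f₀ := Real.sqrt_pos.mpr hf
    positivity
  have hg := hγ hμ (hα.isSteadyState hc3.le hν hf hnn) j
  have hq0 : 0 < (2 : ℝ) ^ (-(c / 3)) := Real.rpow_pos_of_pos two_pos _
  rw [sqrt_r_eq] at hg
  rw [fluxRatio_eq_rescaled c hf α j]
  calc (2 : ℝ) ^ (-(c / 3)) * (α (j + 1) / inviscidFixedPoint c f₀ (j + 1) /
        (α j / inviscidFixedPoint c f₀ j +
          Real.sqrt (α (j + 1) / inviscidFixedPoint c f₀ (j + 1) *
            (α (j + 2) / inviscidFixedPoint c f₀ (j + 2)))))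
      < (2 : ℝ) ^ (-(c / 3)) * ((1 - γ) / (2 * (2 : ℝ) ^ (-(c / 3)))) :=
        mul_lt_mul_of_pos_left hg hq0
    _ = (1 - γ) / 2 := by
        field_simp

/-- **The coefficient bound of (3.9)–(3.10)**: with `γ` as in `exists_gamma_fluxRatio_lt`, every
non-negative `ℓ²` fixed point satisfies
`2^{cj}α_j − 2^{cj}√(2^cα_{j+1}α_{j+2}) < (1 − γ)·ν·2^{2j+1}` for all `j` — because the steady
equation on shell `j+1` gives `2^{cj}(α_j² − 2^cα_{j+1}α_{j+2}) = ν2^{2(j+1)}α_{j+1}`, i.e.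
`2^{cj}(α_j − √(2^cα_{j+1}α_{j+2})) = ν2^{2(j+1)}·[α_{j+1}/(α_j + √(2^cα_{j+1}α_{j+2}))]`.
[cite: CheskidovFriedlander2009, (3.9)–(3.10) p.8 and Lemma 2.4 p.6] -/
theorem exists_gamma_coeff_sub_sqrt_lt (hc : 3 / 2 < c) (hc3 : c < 3) :
    ∃ γ : ℝ, 0 < γ ∧ γ < 1 ∧ ∀ ⦃ν f₀ : ℝ⦄ ⦃α : ℕ → ℝ⦄, 0 < ν → 0 < f₀ →
      IsFixedPoint c ν (force f₀) α → (∀ j, 0 ≤ α j) → ∀ j : ℕ,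
        ((2 : ℝ) ^ c) ^ j * α j - ((2 : ℝ) ^ c) ^ j * Real.sqrt ((2 : ℝ) ^ c * α (j + 1) * α (j + 2))
          < (1 - γ) * ν * (2 : ℝ) ^ (2 * j + 1) := by
  obtain ⟨γ, hγ0, hγ1, hγ⟩ := exists_gamma_fluxRatio_lt hc hc3
  refine ⟨γ, hγ0, hγ1, fun ν f₀ α hν hf hα hnn j => ?_⟩
  have hpos := hα.pos hf hnn
  have hR0 : 0 ≤ Real.sqrt ((2 : ℝ) ^ c * α (j + 1) * α (j + 2)) := Real.sqrt_nonneg _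
  have hR2 : Real.sqrt ((2 : ℝ) ^ c * α (j + 1) * α (j + 2)) ^ 2 = (2 : ℝ) ^ c * α (j + 1) * α (j + 2) :=
    Real.sq_sqrt (by
      have := hpos (j + 1)
      have := hpos (j + 2)
      have : 0 < (2 : ℝ) ^ c := Real.rpow_pos_of_pos two_pos _
      positivity)
  have hden : 0 < α j + Real.sqrt ((2 : ℝ) ^ c * α (j + 1) * α (j + 2)) := by
    have := hpos j
    positivity
  -- the steady equation on shell `j+1`: `−ν4^{j+1}α_{j+1} + p^jα_j² − p^{j+1}α_{j+1}α_{j+2} = 0`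
  have heq := hα.2 (j + 1)
  simp only [rhs, force_succ, add_zero] at heq
  rw [pow_succ ((2 : ℝ) ^ c) j] at heq
  -- `p^j(α_j − R)(α_j + R) = ν4^{j+1}α_{j+1}`
  have hid : ((2 : ℝ) ^ c) ^ j * (α j - Real.sqrt ((2 : ℝ) ^ c * α (j + 1) * α (j + 2))) *
      (α j + Real.sqrt ((2 : ℝ) ^ c * α (j + 1) * α (j + 2))) =
        ν * (2 : ℝ) ^ (2 * (j + 1)) * α (j + 1) := by
    linear_combination heq - ((2 : ℝ) ^ c) ^ j * hR2
  have hratio := hγ hν hf hα hnn j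
  rw [div_lt_iff₀ hden] at hratio
  have h4 : (0 : ℝ) < ν * (2 : ℝ) ^ (2 * (j + 1)) := by positivity
  have hgoal : (((2 : ℝ) ^ c) ^ j * α j -
      ((2 : ℝ) ^ c) ^ j * Real.sqrt ((2 : ℝ) ^ c * α (j + 1) * α (j + 2))) *
        (α j + Real.sqrt ((2 : ℝ) ^ c * α (j + 1) * α (j + 2))) <
      (1 - γ) * ν * (2 : ℝ) ^ (2 * j + 1) *
        (α j + Real.sqrt ((2 : ℝ) ^ c * α (j + 1) * α (j + 2))) := by
    have h1 : (((2 : ℝ) ^ c) ^ j * α j -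
        ((2 : ℝ) ^ c) ^ j * Real.sqrt ((2 : ℝ) ^ c * α (j + 1) * α (j + 2))) *
          (α j + Real.sqrt ((2 : ℝ) ^ c * α (j + 1) * α (j + 2))) =
        ν * (2 : ℝ) ^ (2 * (j + 1)) * α (j + 1) := by
      rw [← hid]
      ring
    have h2 : (1 - γ) * ν * (2 : ℝ) ^ (2 * j + 1) *
        (α j + Real.sqrt ((2 : ℝ) ^ c * α (j + 1) * α (j + 2))) =
        ν * (2 : ℝ) ^ (2 * (j + 1)) *
          ((1 - γ) / 2 * (α j + Real.sqrt ((2 : ℝ) ^ c * α (j + 1) * α (j + 2)))) := by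
      rw [show 2 * (j + 1) = (2 * j + 1) + 1 by ring, pow_succ]
      ring
    rw [h1, h2]
    exact mul_lt_mul_of_pos_left hratio h4
  exact lt_of_mul_lt_mul_right hgoal hden.le

end Literature.Analysis.FluidPDE.CheskidovFriedlander2009

end
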